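import Summits.AtomisticToContinuum.BoseEinsteinCondensation.Theorems.StaticResponseBound.Negative.ModulationBootstrapEndgame
import Summits.AtomisticToContinuum.BoseEinsteinCondensation.Theorems.BECInsertionCorrectorStaticResponseBoundFreeSquare
import Summits.AtomisticToContinuum.BoseEinsteinCondensation.Theorems.BECInsertionCorrectorStaticResponseBoundTruncationMonotone
import Summits.AtomisticToContinuum.BoseEinsteinCondensation.Theorems.BECInsertionCorrectorStaticResponseBoundModInfBasic
import HarnessLib

/-!
# Line `uv-thomson-force-wave` (crux `StaticResponseBound`, stmt-AtomisticToContinuum-12057): the composition, in the tree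

Helper file (supports, does not close, the crux item) for line `uv-thomson-force-wave`, skeleton v4 (seat c1).
It lands the KERNEL-CHECKED COMPOSITION of the skeleton as theorems of the tree, so that the crux is reduced BY NAME to
its registered crux-sized stubs:

* `modulationBound_of_curvature'` — fixed-volume modulation bound from local curvature: for any real function `E`
  below the modulated family `E_w(Ψ) + s⟨∑cos⟩_Ψ`, equal to `E₀` at `s = 0`, continuous, maximal at `0`, with local
  symmetric second differences `≥ −2(K′+ε)δ²` on `s² ≤ T`, one gets `E₀ − K′t² ≤ E_w(Ψ) + t⟨∑cos⟩_Ψ` for `t² ≤ T`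
  (the landed Schwarz maximum principle `UvThomsonG3.quadratic_lower_bound_of_second_differences`).
* `kineticBranch_of_truncationLimit_of_uvCurvature` (registered helper) — the UV HALF of the crux (`KineticBranch`:
  the crux's inequality on a window `M₀²ρa < |p|²`, all `N ≥ 1`) from the truncation limit `TruncationLimit` (S2) and
  the curvature stub `UvCurvatureBound` (texts verbatim, the modulated ground-state energy written out as the real
  `⨅` over finite-energy states), using the LANDED `stub_modInfBasic`, `stub_modInfTranslate`, `stub_freeSquare`.
* `staticResponseBound_of_halves` (registered helper) — **the crux BY NAME from `InfraredHalf`, `TruncationLimit`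
  and `UvCurvatureBound`** (split at `|p|² = M₀²ρa`, `N = 0` by `ineq_N_zero`, `ρ₀ = min`, `C = max`).

With `truncationLimit_of_maxFormBound` (…TruncationCompactness) resp. `stub_truncationLimit_integrable`
(…BECThomsonPrincipleDensityResponseTruncationLimit: S2 holds at every `(v,N,L)` with `∫ v < ∞`) the hypothesis
`TruncationLimit` is itself reduced to `MaxFormBound` (hard cores) or discharged (integrable `v`).

References: the skeleton `Cruxes/StaticResponseBound/Lines/uv_thomson_force_wave.lean`; R. P. Feynman, Phys. Rev. 94
(1954) 262 (the `f`-sum/Thomson bound behind the UV branch).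
-/

noncomputable section

namespace Summit.AtomisticToContinuum.BoseEinsteinCondensation.Cruxes.StaticResponseBound.UvThomsonForceWave

open MeasureTheory Filter
open scoped ENNReal NNReal BigOperators Topology
open Literature.MathematicalPhysics.QuantumManyBody.BoseGas
open Summit.AtomisticToContinuum.BoseEinsteinCondensation.Theses
open Summit.AtomisticToContinuum.BoseEinsteinCondensation.Theses.BECInsertionCorrector
open Summit.AtomisticToContinuum.BoseEinsteinCondensation.Theorems.StaticResponseBound.Negative

/-- Monotonicity of the crux's inner inequality in the constant. [folklore] -/
theorem ineq_mono_const {v : ℝ → ℝ≥0∞} {C C' ρ : ℝ} {N : ℕ} {k : Fin 3 → ℤ} {t : ℝ}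
    {Ψ : PeriodicTrialState N (sideLength ρ N)} (h : Ineq v C ρ N k t Ψ) (hCC' : C ≤ C') :
    Ineq v C' ρ N k t Ψ := by
  unfold Ineq at h ⊢
  have hmax : 0 ≤ max (ρ * (scatteringLength v).toReal) (psq (sideLength ρ N) k) :=
    le_max_of_le_right (psq_nonneg _ _)
  have hle : C * t ^ 2 * N / max (ρ * (scatteringLength v).toReal) (psq (sideLength ρ N) k) ≤
      C' * t ^ 2 * N / max (ρ * (scatteringLength v).toReal) (psq (sideLength ρ N) k) := by
    apply div_le_div_of_nonneg_right _ hmax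
    have : (0 : ℝ) ≤ t ^ 2 * N := by positivity
    nlinarith
  linarith

/-- **Fixed-volume modulation bound from local curvature.** Let `E : ℝ → ℝ` be below the modulated family
(`E s ≤ E_w(Ψ) + s⟨∑cos⟩_Ψ` for finite-energy `Ψ`), with `E 0 = E₀(w)`, continuous, maximal at `0`, and with local
symmetric second differences `≥ −2(K′+ε)δ²` at every `s² ≤ T`.  Then `E₀(w) − K′t² ≤ E_w(Ψ) + t⟨∑cos⟩_Ψ` for all
`t² ≤ T` and all finite-energy `Ψ` (Schwarz maximum principle `quadratic_lower_bound_of_second_differences`). [folklore] -/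
theorem modulationBound_of_curvature' {w : ℝ → ℝ≥0∞} {N : ℕ} {L : ℝ} {k : Fin 3 → ℤ} {E : ℝ → ℝ}
    (hle : ∀ (s : ℝ) (Ψ : PeriodicTrialState N L), periodicEnergy w Ψ ≠ ⊤ →
      E s ≤ (periodicEnergy w Ψ).toReal + s * cosMean L k Ψ)
    (h0 : E 0 = (periodicGroundStateEnergy w N L).toReal) (hcont : Continuous E) (hmax : ∀ t, E t ≤ E 0)
    {K' T : ℝ} (hK' : 0 ≤ K')
    (hcurv : ∀ s : ℝ, s ^ 2 ≤ T → ∀ ε : ℝ, 0 < ε → ∃ δ₀ : ℝ, 0 < δ₀ ∧ ∀ δ : ℝ, 0 < δ → δ < δ₀ →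
      -(2 * (K' + ε) * δ ^ 2) ≤ E (s + δ) + E (s - δ) - 2 * E s)
    (t : ℝ) (ht : t ^ 2 ≤ T) (Ψ : PeriodicTrialState N L) (hΨ : periodicEnergy w Ψ ≠ ⊤) :
    (periodicGroundStateEnergy w N L).toReal - K' * t ^ 2 ≤
      (periodicEnergy w Ψ).toReal + t * cosMean L k Ψ := by
  have key := UvThomsonG3.quadratic_lower_bound_of_second_differences (E := E) (K := K') (T := T) hK' hcont hmax
    hcurv t ht
  rw [h0] at key
  exact key.trans (hle t Ψ hΨ)

/-- **Registered helper `kineticBranch_of_truncationLimit_of_uvCurvature`: the UV half of the crux from the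
truncation limit (S2) and the curvature stub (`UvCurvatureBound`).**  Constants `M₀ = √Λ`, `ρ₀ = ρ₁`, `C = C₁ + 1`,
`C₁ = max(K, 1)`.  For `N ≥ 1`, `k ≠ 0` in the window `Λρa ≤ |p|²` (`max(ρa,|p|²) = |p|²`): if `|p|²·E₀(v) ≤ C₁N t²`
the free square (`stub_freeSquare`) gives it; otherwise `N t² < |p|²·E₀(v)` with room `δ`, so by S2
`t² ≤ |p|²·E₀(v_n)/N` for `n` large, and the curvature stub for `v_n` (constant `KN/|p|²`) with
`modulationBound_of_curvature'` applied to the modulated ground-state energy of `v_n` (order facts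
`stub_modInfBasic`, translate `stub_modInfTranslate`) gives `E₀(v_n) − (KN/|p|²)t² ≤ E_{v_n}(Ψ) + t⟨∑cos⟩ ≤
E_v(Ψ) + t⟨∑cos⟩`, and `E₀(v_n) → E₀(v)` (S2). [folklore] -/
theorem kineticBranch_of_truncationLimit_of_uvCurvature :
    (∀ v : ℝ → ℝ≥0∞, IsRepulsiveFiniteRange v → ∀ (N : ℕ) (L : ℝ), 0 < L →
      periodicGroundStateEnergy v N L ≠ ⊤ →
      ∀ ε : ℝ, 0 < ε → ∃ n₁ : ℕ, ∀ n : ℕ, n₁ ≤ n →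
        (periodicGroundStateEnergy v N L).toReal ≤
          (periodicGroundStateEnergy (truncPotential v n) N L).toReal + ε) →
    (∀ v : ℝ → ℝ≥0∞, IsRepulsiveFiniteRange v →
      ∃ Λ : ℝ, 1 ≤ Λ ∧ ∃ ρ₁ : ℝ, 0 < ρ₁ ∧ ∃ K : ℝ, 0 ≤ K ∧ ∃ n₀ : ℕ, ∀ n : ℕ, n₀ ≤ n →
        ∀ ρ : ℝ, 0 < ρ → ρ < ρ₁ → ∀ N : ℕ, 1 ≤ N → ∀ k : Fin 3 → ℤ, k ≠ 0 →
          Λ * (ρ * (scatteringLength v).toReal) ≤ psq (sideLength ρ N) k →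
          ∀ s : ℝ, s ^ 2 ≤ psq (sideLength ρ N) k *
              (periodicGroundStateEnergy (truncPotential v n) N (sideLength ρ N)).toReal / N →
          ∀ ε : ℝ, 0 < ε → ∃ δ₀ : ℝ, 0 < δ₀ ∧ ∀ δ : ℝ, 0 < δ → δ < δ₀ →
            -(2 * (K * N / psq (sideLength ρ N) k + ε) * δ ^ 2) ≤
              (⨅ Ψ : {Ψ : PeriodicTrialState N (sideLength ρ N) // periodicEnergy (truncPotential v n) Ψ ≠ ⊤},
                  ((periodicEnergy (truncPotential v n) Ψ.1).toReal +
                    (s + δ) * cosMean (sideLength ρ N) k Ψ.1)) +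
              (⨅ Ψ : {Ψ : PeriodicTrialState N (sideLength ρ N) // periodicEnergy (truncPotential v n) Ψ ≠ ⊤},
                  ((periodicEnergy (truncPotential v n) Ψ.1).toReal +
                    (s - δ) * cosMean (sideLength ρ N) k Ψ.1)) -
              2 * (⨅ Ψ : {Ψ : PeriodicTrialState N (sideLength ρ N) // periodicEnergy (truncPotential v n) Ψ ≠ ⊤},
                  ((periodicEnergy (truncPotential v n) Ψ.1).toReal +
                    s * cosMean (sideLength ρ N) k Ψ.1))) →
    ∀ v : ℝ → ℝ≥0∞, IsRepulsiveFiniteRange v →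
      ∃ M₀ : ℝ, 0 < M₀ ∧ ∃ ρ₀ : ℝ, 0 < ρ₀ ∧ ∃ C : ℝ, 0 < C ∧
        ∀ ρ : ℝ, 0 < ρ → ρ < ρ₀ → ∀ N : ℕ, 0 < N → ∀ k : Fin 3 → ℤ, k ≠ 0 →
          M₀ ^ 2 * (ρ * (scatteringLength v).toReal) < psq (sideLength ρ N) k →
          ∀ t : ℝ, ∀ Ψ : PeriodicTrialState N (sideLength ρ N), periodicEnergy v Ψ ≠ ⊤ →
            Ineq v C ρ N k t Ψ := by
  intro h₂ h₅ v hv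
  obtain ⟨Λ, hΛ, ρ₁, hρ₁, K, hK, n₀, hUV⟩ := h₅ v hv
  have hΛpos : 0 < Λ := lt_of_lt_of_le one_pos hΛ
  -- opaque name for the constant `C₁ = max K 1`
  obtain ⟨C₁, hC₁def⟩ : ∃ C₁ : ℝ, C₁ = max K 1 := ⟨_, rfl⟩
  have hC₁ : 1 ≤ C₁ := hC₁def ▸ le_max_right _ _
  have hKC₁ : K ≤ C₁ := hC₁def ▸ le_max_left _ _
  refine ⟨Real.sqrt Λ, Real.sqrt_pos.mpr hΛpos, ρ₁, hρ₁, C₁ + 1, by linarith, ?_⟩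
  intro ρ hρ hρ1 N hNpos k hk hwin t Ψ hΨ
  rw [Real.sq_sqrt hΛpos.le] at hwin
  have hUVcase : Λ * (ρ * (scatteringLength v).toReal) ≤ psq (sideLength ρ N) k := hwin.le
  have hN1 : 1 ≤ N := hNpos
  have hNR : (0 : ℝ) < N := by exact_mod_cast hNpos
  have hL : 0 < sideLength ρ N := sideLength_pos hρ hNpos
  have hP : 0 < psq (sideLength ρ N) k := freeSq_psq_pos hL hk
  have ha : 0 ≤ ρ * (scatteringLength v).toReal := mul_nonneg hρ.le ENNReal.toReal_nonneg
  have hΛρa : ρ * (scatteringLength v).toReal ≤ Λ * (ρ * (scatteringLength v).toReal) :=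
    le_mul_of_one_le_left ha hΛ
  unfold Ineq
  have hmax : max (ρ * (scatteringLength v).toReal) (psq (sideLength ρ N) k) = psq (sideLength ρ N) k :=
    max_eq_right (hΛρa.trans hUVcase)
  rw [hmax]
  have hfree := stub_freeSquare v N (sideLength ρ N) hL k hk t Ψ hΨ
  have hE0nn : 0 ≤ (periodicGroundStateEnergy v N (sideLength ρ N)).toReal := ENNReal.toReal_nonneg
  have hsplit : (C₁ + 1) * t ^ 2 * N / psq (sideLength ρ N) k =
      C₁ * t ^ 2 * N / psq (sideLength ρ N) k + (N : ℝ) * t ^ 2 / psq (sideLength ρ N) k := by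
    ring
  rcases le_or_gt (psq (sideLength ρ N) k * (periodicGroundStateEnergy v N (sideLength ρ N)).toReal)
      (C₁ * N * t ^ 2) with hA | hBcase
  · -- large coupling: the free square
    have hE0le : (periodicGroundStateEnergy v N (sideLength ρ N)).toReal ≤
        C₁ * t ^ 2 * N / psq (sideLength ρ N) k := by
      rw [le_div_iff₀ hP]
      linarith
    linarith
  · -- small coupling: curvature of the truncated problems + S2
    have hE0fin : periodicGroundStateEnergy v N (sideLength ρ N) ≠ ⊤ :=
      ne_top_of_le_ne_top hΨ (periodicGroundStateEnergy_le v Ψ)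
    obtain ⟨δ, hδ⟩ : ∃ δ : ℝ, δ = psq (sideLength ρ N) k *
        (periodicGroundStateEnergy v N (sideLength ρ N)).toReal - (N : ℝ) * t ^ 2 := ⟨_, rfl⟩
    have hδpos : 0 < δ := by
      have : (N : ℝ) * t ^ 2 ≤ C₁ * N * t ^ 2 := by
        have h0 : 0 ≤ (N : ℝ) * t ^ 2 := by positivity
        nlinarith
      rw [hδ]
      linarith
    have hcore : ∀ ε : ℝ, 0 < ε →
        (periodicGroundStateEnergy v N (sideLength ρ N)).toReal - C₁ * t ^ 2 * N / psq (sideLength ρ N) k ≤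
          (periodicEnergy v Ψ).toReal + t * cosMean (sideLength ρ N) k Ψ + ε := by
      intro ε hε
      have hε' : 0 < min ε (δ / psq (sideLength ρ N) k) := lt_min hε (div_pos hδpos hP)
      obtain ⟨n₁, hn₁⟩ := h₂ v hv N (sideLength ρ N) hL hE0fin _ hε'
      obtain ⟨n, hn⟩ : ∃ n : ℕ, n = max n₀ n₁ := ⟨_, rfl⟩
      have hn0 : n₀ ≤ n := hn ▸ le_max_left _ _
      have hnn1 : n₁ ≤ n := hn ▸ le_max_right _ _
      have hS2 := hn₁ n hnn1
      have hminδ : min ε (δ / psq (sideLength ρ N) k) ≤ δ / psq (sideLength ρ N) k := min_le_right _ _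
      -- the window of the curvature stub for the truncated problem contains `t`
      have hwin' : t ^ 2 ≤ psq (sideLength ρ N) k *
          (periodicGroundStateEnergy (truncPotential v n) N (sideLength ρ N)).toReal / N := by
        rw [le_div_iff₀ hNR]
        have h1 : psq (sideLength ρ N) k * (δ / psq (sideLength ρ N) k) = δ := by
          field_simp
        have h2 : psq (sideLength ρ N) k * (periodicGroundStateEnergy v N (sideLength ρ N)).toReal ≤
            psq (sideLength ρ N) k *
                (periodicGroundStateEnergy (truncPotential v n) N (sideLength ρ N)).toReal +
              psq (sideLength ρ N) k * (δ / psq (sideLength ρ N) k) := by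
          have := mul_le_mul_of_nonneg_left (hS2.trans (add_le_add le_rfl hminδ)) hP.le
          linarith [this]
        rw [h1, hδ] at h2
        linarith
      -- finiteness for the truncated problem
      have hΨn : periodicEnergy (truncPotential v n) Ψ ≠ ⊤ :=
        ne_top_of_le_ne_top hΨ (periodicEnergy_truncPotential_le' v n Ψ)
      have hE0finn : periodicGroundStateEnergy (truncPotential v n) N (sideLength ρ N) ≠ ⊤ :=
        ne_top_of_le_ne_top hΨn (periodicGroundStateEnergy_le _ Ψ)
      -- the modulated ground-state energy of `v_n` as an opaque real function
      obtain ⟨E, hE⟩ : ∃ E : ℝ → ℝ, ∀ s, E s =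
          ⨅ Φ : {Φ : PeriodicTrialState N (sideLength ρ N) // periodicEnergy (truncPotential v n) Φ ≠ ⊤},
            ((periodicEnergy (truncPotential v n) Φ.1).toReal + s * cosMean (sideLength ρ N) k Φ.1) :=
        ⟨_, fun _ => rfl⟩
      obtain ⟨hle, h0, hlip⟩ := stub_modInfBasic (truncPotential v n) N (sideLength ρ N) hL k
      have hle' : ∀ (s : ℝ) (Φ : PeriodicTrialState N (sideLength ρ N)), periodicEnergy (truncPotential v n) Φ ≠ ⊤ →
          E s ≤ (periodicEnergy (truncPotential v n) Φ).toReal + s * cosMean (sideLength ρ N) k Φ :=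
        fun s Φ hΦ => (hE s).symm ▸ hle s Φ hΦ
      have h0' : E 0 = (periodicGroundStateEnergy (truncPotential v n) N (sideLength ρ N)).toReal := by
        rw [hE]; exact h0 hE0finn
      have hcont : Continuous E := by
        have hLip : LipschitzWith (N : ℝ≥0) E := by
          refine LipschitzWith.of_dist_le_mul fun s s' => ?_
          rw [Real.dist_eq, Real.dist_eq, hE, hE]
          simpa using hlip hE0finn s s'
        exact hLip.continuous
      have hmax' : ∀ t, E t ≤ E 0 := fun t => by
        rw [hE, hE]; exact stub_modInfTranslate (truncPotential v n) N (sideLength ρ N) hL k hk t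
      -- the curvature stub at height `n`, momentum `k`, as the hypothesis of `modulationBound_of_curvature'`
      have hcurv : ∀ s : ℝ, s ^ 2 ≤ psq (sideLength ρ N) k *
            (periodicGroundStateEnergy (truncPotential v n) N (sideLength ρ N)).toReal / N →
          ∀ ε : ℝ, 0 < ε → ∃ δ₀ : ℝ, 0 < δ₀ ∧ ∀ δ : ℝ, 0 < δ → δ < δ₀ →
            -(2 * (K * N / psq (sideLength ρ N) k + ε) * δ ^ 2) ≤ E (s + δ) + E (s - δ) - 2 * E s := by
        intro s hs ε₁ hε₁
        obtain ⟨δ₀, hδ₀, hδ₀'⟩ := hUV n hn0 ρ hρ hρ1 N hN1 k hk hUVcase s hs ε₁ hε₁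
        refine ⟨δ₀, hδ₀, fun δ' hδ' hδ'lt => ?_⟩
        rw [hE, hE, hE]
        exact hδ₀' δ' hδ' hδ'lt
      have hboot := modulationBound_of_curvature' hle' h0' hcont hmax' (K' := K * N / psq (sideLength ρ N) k)
        (by positivity) hcurv t hwin' Ψ hΨn
      -- transfer energies from `v_n` to `v`
      have hEΨ : (periodicEnergy (truncPotential v n) Ψ).toReal ≤ (periodicEnergy v Ψ).toReal :=
        ENNReal.toReal_mono hΨ (periodicEnergy_truncPotential_le' v n Ψ)
      have hconst : K * N / psq (sideLength ρ N) k * t ^ 2 ≤ C₁ * t ^ 2 * N / psq (sideLength ρ N) k := by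
        rw [div_mul_eq_mul_div, div_le_div_iff_of_pos_right hP]
        have h0 : 0 ≤ (N : ℝ) * t ^ 2 := by positivity
        nlinarith
      have hminε : min ε (δ / psq (sideLength ρ N) k) ≤ ε := min_le_left _ _
      linarith
    have hfinal : (periodicGroundStateEnergy v N (sideLength ρ N)).toReal -
          C₁ * t ^ 2 * N / psq (sideLength ρ N) k ≤
        (periodicEnergy v Ψ).toReal + t * cosMean (sideLength ρ N) k Ψ :=
      le_of_forall_pos_le_add hcore
    have hextra : 0 ≤ (N : ℝ) * t ^ 2 / psq (sideLength ρ N) k := by positivity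
    linarith

/-- **Registered helper `staticResponseBound_of_halves`: the crux `StaticResponseBound` BY NAME from the infrared half
(`InfraredHalf`, S1), the truncation limit (`TruncationLimit`, S2) and the curvature stub (`UvCurvatureBound`).**
`N = 0` by `ineq_N_zero`; for `N ≥ 1` split at `|p|² = M₀²ρa` between the infrared half and the UV half
`kineticBranch_of_truncationLimit_of_uvCurvature`; `ρ₀ = min`, `C = max` (`ineq_mono_const`). [folklore] -/
theorem staticResponseBound_of_halves :
    (∀ v : ℝ → ℝ≥0∞, IsRepulsiveFiniteRange v → ∀ M₀ : ℝ, 0 < M₀ →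
      ∃ ρ₀ : ℝ, 0 < ρ₀ ∧ ∃ C : ℝ, 0 < C ∧
        ∀ ρ : ℝ, 0 < ρ → ρ < ρ₀ → ∀ N : ℕ, 0 < N → ∀ k : Fin 3 → ℤ, k ≠ 0 →
          psq (sideLength ρ N) k ≤ M₀ ^ 2 * (ρ * (scatteringLength v).toReal) →
          ∀ t : ℝ, ∀ Ψ : PeriodicTrialState N (sideLength ρ N), periodicEnergy v Ψ ≠ ⊤ →
            Ineq v C ρ N k t Ψ) →
    (∀ v : ℝ → ℝ≥0∞, IsRepulsiveFiniteRange v → ∀ (N : ℕ) (L : ℝ), 0 < L →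
      periodicGroundStateEnergy v N L ≠ ⊤ →
      ∀ ε : ℝ, 0 < ε → ∃ n₁ : ℕ, ∀ n : ℕ, n₁ ≤ n →
        (periodicGroundStateEnergy v N L).toReal ≤
          (periodicGroundStateEnergy (truncPotential v n) N L).toReal + ε) →
    (∀ v : ℝ → ℝ≥0∞, IsRepulsiveFiniteRange v →
      ∃ Λ : ℝ, 1 ≤ Λ ∧ ∃ ρ₁ : ℝ, 0 < ρ₁ ∧ ∃ K : ℝ, 0 ≤ K ∧ ∃ n₀ : ℕ, ∀ n : ℕ, n₀ ≤ n →
        ∀ ρ : ℝ, 0 < ρ → ρ < ρ₁ → ∀ N : ℕ, 1 ≤ N → ∀ k : Fin 3 → ℤ, k ≠ 0 →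
          Λ * (ρ * (scatteringLength v).toReal) ≤ psq (sideLength ρ N) k →
          ∀ s : ℝ, s ^ 2 ≤ psq (sideLength ρ N) k *
              (periodicGroundStateEnergy (truncPotential v n) N (sideLength ρ N)).toReal / N →
          ∀ ε : ℝ, 0 < ε → ∃ δ₀ : ℝ, 0 < δ₀ ∧ ∀ δ : ℝ, 0 < δ → δ < δ₀ →
            -(2 * (K * N / psq (sideLength ρ N) k + ε) * δ ^ 2) ≤
              (⨅ Ψ : {Ψ : PeriodicTrialState N (sideLength ρ N) // periodicEnergy (truncPotential v n) Ψ ≠ ⊤},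
                  ((periodicEnergy (truncPotential v n) Ψ.1).toReal +
                    (s + δ) * cosMean (sideLength ρ N) k Ψ.1)) +
              (⨅ Ψ : {Ψ : PeriodicTrialState N (sideLength ρ N) // periodicEnergy (truncPotential v n) Ψ ≠ ⊤},
                  ((periodicEnergy (truncPotential v n) Ψ.1).toReal +
                    (s - δ) * cosMean (sideLength ρ N) k Ψ.1)) -
              2 * (⨅ Ψ : {Ψ : PeriodicTrialState N (sideLength ρ N) // periodicEnergy (truncPotential v n) Ψ ≠ ⊤},
                  ((periodicEnergy (truncPotential v n) Ψ.1).toReal +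
                    s * cosMean (sideLength ρ N) k Ψ.1))) →
    StaticResponseBound := by
  intro h₁ h₂ h₅ v hv
  obtain ⟨M₀, hM₀, ρ₁, hρ₁, C₁, hC₁, hKin⟩ := kineticBranch_of_truncationLimit_of_uvCurvature h₂ h₅ v hv
  obtain ⟨ρ₂, hρ₂, C₂, hC₂, hPh⟩ := h₁ v hv M₀ hM₀
  refine ⟨min ρ₁ ρ₂, lt_min hρ₁ hρ₂, max C₁ C₂, lt_of_lt_of_le hC₁ (le_max_left _ _), ?_⟩
  intro ρ hρ hρlt N k hk t Ψ hΨ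
  change Ineq v (max C₁ C₂) ρ N k t Ψ
  rcases Nat.eq_zero_or_pos N with hN | hN
  · subst hN
    exact ineq_N_zero v _ ρ k t Ψ hΨ
  · rcases le_or_gt (psq (sideLength ρ N) k) (M₀ ^ 2 * (ρ * (scatteringLength v).toReal)) with hle | hlt
    · exact ineq_mono_const (hPh ρ hρ (lt_of_lt_of_le hρlt (min_le_right _ _)) N hN k hk hle t Ψ hΨ)
        (le_max_right _ _)
    · exact ineq_mono_const (hKin ρ hρ (lt_of_lt_of_le hρlt (min_le_left _ _)) N hN k hk hlt t Ψ hΨ)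
        (le_max_left _ _)

end Summit.AtomisticToContinuum.BoseEinsteinCondensation.Cruxes.StaticResponseBound.UvThomsonForceWave

end
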